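import Summits.QuantumFields.BalabanUV.T4Continuum.Support.B13Carriers

/-!
# NE5 ∕ node U3, row O1-a follower — `B13CarriersFootprint`: the LATTICE FOOTPRINTS of a localization domain of the two-run carriers
# of record `B13Carriers.TwoRuns.carriers` on BOTH runs' lattices (which sites ∕ bonds of any level of run A, resp. run B, lie in `X`),
# and the elementary two-run arithmetic (`ε_{K+1} = ε_K/L`, equal physical size of paired levels, `M · #cubes = #sites`)

Cell `pub-balaban`, T⁴ sub-cell, NE5 formalisation swarm seat `b2b-balaban-t4-ne5-formalise-leaf-05` (holder of row O1-a CARRIERS;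
instance of record `Support/B13Carriers.lean` p207668 ADOPTED, journal l.5870 (3)(i)).  Summits-side NEW WORK under the LEAN
PLACEMENT RULE: TYPING + finite bookkeeping only — no estimate of the manuscripts is used or asserted; nothing of `B13Carriers` is
edited (imported BY NAME).  HONEST FRAMING (T4-DAG p. 1): rung (B)+1 on a FIXED finite torus T⁴ — NOT infinite volume, NOT a mass
gap, NOT the Clay problem; NE5 NOT PROVED; spine 0∕9.  HONEST DEPENDENCY (cell line, verbatim): continuum YM on T⁴ ⇐ BetaPertH ∧
nine spine estimates (0/9 proved); BetaPertH ⇐ (D1) ∧ (D4) ∧ CAP+tail; G-an2-4 gates asym, D1 and NE2/3/4.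

WHY.  Rows O1-b ∕ O1-c ∕ O1-d must say «the operator datum ∕ the potential ∕ the term localized at `X`» and «`U` restricted to `X`»
([Balaban1987RG1] p. 257: *"E^{(j)}(X, U) are analytic and gauge invariant functions of U, depending on U restricted to X"*; p. 262:
*"The gauge field configuration U is defined at bonds of X"*), for configurations on the FINEST lattice of either run and for the
unit-lattice fluctuation field of the step; the carriers of record index a domain by (creation step `j`, a family of cubes of `π_j`),
the cubes of `π_j` being indexed by the sites of the centre lattice `T^{(j+m')}` (p. 257: *"cubes of a size M, where M = L^m̄, with
centers at points of the lattice T_ξ^{(j+m̄)}"*).  This file supplies the dictionary SITE ↦ CUBE for every level of both runs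
(coordinatewise integer quotient of the label — the centred-block convention of `Setup.blockOf`, iterated) and the resulting
finite sets of sites ∕ bonds of a domain, with the consistency of the two runs' readings under the level identification
`T4LevelShift.siteShift` (run B's level `i + 1` IS run A's level `i`).

WHAT IS PROVED (kernel-checked), for every `R : B13Carriers.TwoRuns G`.  §1 arithmetic: `eps_runB` (`ε_{K+1} = ε_K / L`),
`physSize_pair` (`L^i ε_K = L^{i+1} ε_{K+1}`), `sitesPerDir_pair` (level `i` of run A = level `i + 1` of run B, every `i`),
`cubeSide_mul_cubesPerDir` (`L^{m'} · #cubes of π_j = #sites of T^{(j)}` per direction in the meaningful range `j + m' ≤ m + K`).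
§2 `toCube R i j : Site (F.P K) i → TPt 4 (R.cubesPerDir j)` and `toCubeB R i j : Site (F.P (K+1)) i → TPt 4 (R.cubesPerDir j)`, the
identity at the centre level (`toCube_self`) and the paired-level consistency (`toCubeB_succ_eq`).  §3 for `X : R.carriers.Dom`: the
finite sets `sitesAt X i`, `bondsAt X i` (run A, any level `i`), `sitesAtB X i`, `bondsAtB X i` (run B, any level, in particular its
finest `i = 0` which has no run-A counterpart), membership simp lemmas, `mem_sitesAt_self` (the centre-level sites in `X` are its
cubes), `siteShift_mem_sitesAtB_iff`.  PRINTED TYPES (locators only): [Balaban1987RG1] (0.1) p. 251, p. 257, p. 262.  0 sorry;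
axioms ⊆ {propext, Classical.choice, Quot.sound}.
-/

noncomputable section

namespace Summit.QuantumFields.BalabanUV.T4Continuum.B13CarriersFootprint

open Literature.MathematicalPhysics.QuantumFieldTheory.Balaban1983to89
open Literature.MathematicalPhysics.QuantumFieldTheory.Balaban1983to89.TreeLengthTorus (TPt TDom)
open Literature.MathematicalPhysics.QuantumFieldTheory.Balaban1983to89.T4LevelShift (sitesPerDir_ladder siteShift)
open Summit.QuantumFields.BalabanUV.T4Continuum.B13Carriers (TwoRuns)

variable {G : Type} [GaugeGroup G] (R : TwoRuns G)

/-! ## §1 Two-run arithmetic of the fixed torus -/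

/-- Level `i` of run A and level `i + 1` of run B have the same number of sites per direction, `2·L^{m+K−i}` — they are ONE lattice of
the fixed torus ([Balaban1987RG1] (0.1) p. 251 with `ε ↦ L^iε`; the tree's `T4LevelShift.sitesPerDir_ladder`; `i = 0` is
`B13Carriers.sitesPerDir_runA_zero`). [cite: Balaban1987RG1, (0.1) p.251] -/
theorem sitesPerDir_pair (i : ℕ) : (R.F.P R.K).sitesPerDir i = (R.F.P (R.K + 1)).sitesPerDir (i + 1) :=
  sitesPerDir_ladder R.F rfl rfl

/-- Run B's lattice spacing is run A's divided by the block size: `ε_{K+1} = ε_K / L`. [folklore] -/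
theorem eps_runB : (R.F.P (R.K + 1)).eps = (R.F.P R.K).eps / R.F.L := by
  simp only [Params.eps, T4Continuum.T4Family.P_L, T4Continuum.T4Family.P_K, pow_succ, div_eq_mul_inv]

/-- The PHYSICAL SIZE of the paired levels agrees: `L^i ε_K = L^{i+1} ε_{K+1}`. [folklore] -/
theorem physSize_pair (i : ℕ) : (R.F.L : ℝ) ^ i * (R.F.P R.K).eps = (R.F.L : ℝ) ^ (i + 1) * (R.F.P (R.K + 1)).eps := by
  have hL : (R.F.L : ℝ) ≠ 0 := by have := R.F.hL.2; exact_mod_cast (show R.F.L ≠ 0 by omega)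
  rw [eps_runB, pow_succ]
  field_simp

/-- In the meaningful range `j + m' ≤ m + K` the cubes of `π_j` tile the level-`j` lattice exactly: `L^{m'} · #cubes = #sites` per
direction ([Balaban1987RG1] p. 257: cubes of side `M = L^{m'}`). [folklore] -/
theorem cubeSide_mul_cubesPerDir {j : ℕ} (h : j + R.m' ≤ R.F.m + R.K) :
    R.F.L ^ R.m' * R.cubesPerDir j = (R.F.P R.K).sitesPerDir j := by
  simp only [TwoRuns.cubesPerDir, Params.sitesPerDir, T4Continuum.T4Family.P_L, T4Continuum.T4Family.P_m,
    T4Continuum.T4Family.P_K]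
  have hsplit : R.F.m + R.K - j = R.m' + (R.F.m + R.K - (j + R.m')) := by omega
  rw [hsplit, pow_add]
  ring

/-! ## §2 The cube of `π_j` containing a site, for every level of either run -/

/-- THE CUBE OF A RUN-A SITE: a site `x` of level `i` of run A lies in the cube of `π_j` whose index (a site of the centre lattice
`T^{(j+m')}`) is the coordinatewise integer quotient of its label by `L^{j+m'−i}` (meaningful for `i ≤ j + m'`; the centred-block
convention of `Setup.blockOf`, iterated). [cite: Balaban1987RG1, p.257 (localization domains)] -/
def toCube (i j : ℕ) (x : Site (R.F.P R.K) i) : TPt 4 (R.cubesPerDir j) :=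
  fun ν => (((x ν).val / R.F.L ^ (j + R.m' - i) : ℕ) : ZMod (R.cubesPerDir j))

/-- Unfolding `toCube`. [folklore] -/
@[simp] theorem toCube_apply (i j : ℕ) (x : Site (R.F.P R.K) i) (ν : Fin 4) :
    toCube R i j x ν = (((x ν).val / R.F.L ^ (j + R.m' - i) : ℕ) : ZMod (R.cubesPerDir j)) := rfl

/-- At the centre level itself `toCube` is the identity (a cube index is its own cube). [folklore] -/
theorem toCube_self (j : ℕ) (a : Site (R.F.P R.K) (j + R.m')) : toCube R (j + R.m') j a = a := by
  funext ν
  simp only [toCube_apply, Nat.sub_self, pow_zero, Nat.div_one]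
  exact ZMod.natCast_zmod_val (a ν)

/-- THE CUBE OF A RUN-B SITE: a site `y` of level `i` of run B (its finest lattice `T_{ε/L}` at `i = 0`) lies in the cube of `π_j`
(run-A numbering; run B's level `j + 1 + m'`, `B13Carriers.TwoRuns.cubesPerDir_runB`) whose index is the coordinatewise quotient of
its label by `L^{j+1+m'−i}`. [cite: Balaban1987RG1, p.257 (localization domains)] -/
def toCubeB (i j : ℕ) (y : Site (R.F.P (R.K + 1)) i) : TPt 4 (R.cubesPerDir j) :=
  fun ν => (((y ν).val / R.F.L ^ (j + 1 + R.m' - i) : ℕ) : ZMod (R.cubesPerDir j))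

/-- Unfolding `toCubeB`. [folklore] -/
@[simp] theorem toCubeB_apply (i j : ℕ) (y : Site (R.F.P (R.K + 1)) i) (ν : Fin 4) :
    toCubeB R i j y ν = (((y ν).val / R.F.L ^ (j + 1 + R.m' - i) : ℕ) : ZMod (R.cubesPerDir j)) := rfl

/-- CONSISTENCY OF THE TWO READINGS at paired levels: a run-B site of level `i + 1` and the run-A site of level `i` it IS (under the
level identification `T4LevelShift.siteShift`) lie in the same cube of `π_j`. [folklore] -/
theorem toCubeB_succ_eq (i j : ℕ) (x : Site (R.F.P R.K) i) :
    toCubeB R (i + 1) j (siteShift (sitesPerDir_pair R i) x) = toCube R i j x := by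
  funext ν
  simp only [toCubeB_apply, toCube_apply, T4LevelShift.siteShift_apply, T4LevelShift.coordEquiv_val]
  congr 3
  omega

/-! ## §3 The sites and bonds of either run lying in a domain -/

variable {R}

/-- THE SITES OF RUN A (any level `i`) LYING IN THE DOMAIN `X`: those whose cube of `π_{scale X}` belongs to `X`'s family — the reading
of *"depending on U restricted to X"* (p. 257) and *"U is defined at bonds of X"* (p. 262); a `Finset`, so that localized sums
`∑ x ∈ sitesAt X i, …` elaborate. [cite: Balaban1987RG1, p.262 (configurations on X)] -/
def sitesAt (X : R.carriers.Dom) (i : ℕ) : Finset (Site (R.F.P R.K) i) :=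
  Finset.univ.filter fun x => toCube R i X.1 x ∈ X.2.1

/-- The positively oriented BONDS OF RUN A lying in `X`: those whose initial point does (bonds are attached to their initial point,
as in `Setup.Averaging.local_dep`). [cite: Balaban1987RG1, p.262 (configurations on X)] -/
def bondsAt (X : R.carriers.Dom) (i : ℕ) : Finset (PBond (R.F.P R.K) i) :=
  Finset.univ.filter fun b => b.src ∈ sitesAt X i

/-- THE SITES OF RUN B (any level `i`, in particular its finest `i = 0`, which has no run-A counterpart) lying in `X`.
[cite: Balaban1987RG1, p.262 (configurations on X)] -/
def sitesAtB (X : R.carriers.Dom) (i : ℕ) : Finset (Site (R.F.P (R.K + 1)) i) :=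
  Finset.univ.filter fun y => toCubeB R i X.1 y ∈ X.2.1

/-- The bonds of run B lying in `X` (attached to their initial point). [cite: Balaban1987RG1, p.262 (configurations on X)] -/
def bondsAtB (X : R.carriers.Dom) (i : ℕ) : Finset (PBond (R.F.P (R.K + 1)) i) :=
  Finset.univ.filter fun c => c.src ∈ sitesAtB X i

/-- Membership in `sitesAt`. [folklore] -/
@[simp] theorem mem_sitesAt (X : R.carriers.Dom) {i : ℕ} (x : Site (R.F.P R.K) i) :
    x ∈ sitesAt X i ↔ toCube R i X.1 x ∈ X.2.1 := by
  simp [sitesAt]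

/-- Membership in `bondsAt`. [folklore] -/
@[simp] theorem mem_bondsAt (X : R.carriers.Dom) {i : ℕ} (b : PBond (R.F.P R.K) i) :
    b ∈ bondsAt X i ↔ b.src ∈ sitesAt X i := by
  simp [bondsAt]

/-- Membership in `sitesAtB`. [folklore] -/
@[simp] theorem mem_sitesAtB (X : R.carriers.Dom) {i : ℕ} (y : Site (R.F.P (R.K + 1)) i) :
    y ∈ sitesAtB X i ↔ toCubeB R i X.1 y ∈ X.2.1 := by
  simp [sitesAtB]

/-- Membership in `bondsAtB`. [folklore] -/
@[simp] theorem mem_bondsAtB (X : R.carriers.Dom) {i : ℕ} (c : PBond (R.F.P (R.K + 1)) i) :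
    c ∈ bondsAtB X i ↔ c.src ∈ sitesAtB X i := by
  simp [bondsAtB]

/-- The centre-level sites of scale `scale X` lying in `X` are exactly its cubes (`toCube_self`). [folklore] -/
theorem mem_sitesAt_self (X : R.carriers.Dom) (a : Site (R.F.P R.K) (X.1 + R.m')) :
    a ∈ sitesAt X (X.1 + R.m') ↔ a ∈ X.2.1 := by
  rw [mem_sitesAt, toCube_self]
  exact Iff.rfl

/-- The two readings agree at paired levels: a run-A site of level `i` lies in `X` iff the run-B site of level `i + 1` it IS (under
`T4LevelShift.siteShift`) does. [folklore] -/
theorem siteShift_mem_sitesAtB_iff (X : R.carriers.Dom) {i : ℕ} (x : Site (R.F.P R.K) i) :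
    siteShift (sitesPerDir_pair R i) x ∈ sitesAtB X (i + 1) ↔ x ∈ sitesAt X i := by
  rw [mem_sitesAtB, mem_sitesAt, toCubeB_succ_eq]

/-- A domain's site footprint at its own centre level is non-empty (a localization domain has a cube). [folklore] -/
theorem sitesAt_self_nonempty (X : R.carriers.Dom) : (sitesAt X (X.1 + R.m')).Nonempty := by
  obtain ⟨a, ha⟩ := X.2.2.1
  exact ⟨a, (mem_sitesAt_self X a).2 ha⟩

end Summit.QuantumFields.BalabanUV.T4Continuum.B13CarriersFootprint

end
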